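import Summits.CriticalPhenomena.PercolationContinuityZ3.Theorems.PercNearOneGluingNoHeavyLowerTailSahiCombTriWFaceMin

/-!
# FACE-MIN at the coordinate with the largest bottom face — a choice rule for `FaceMinExistsIneq`

Support file of the one-cut programme (crux `NoHeavyLowerTail`, stmt-CriticalPhenomena-4575; cell `prim-masterthm`, seat P5 gen 25;
memo `FROM-prim-masterthm-p5-g25-CYLINDER-CLOSURE.md` §2f).

`FaceMinExistsIneq` (`…SahiCombTriWFaceMin`, P5 gen 17) — SOME coordinate `i` has `min (triW P⁰ F⁰ G⁰) (triW P¹ F¹ G¹) ≤ triW P F G` — drives the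
induction on the dimension of the cube (`triWIneq_of_faceMinExistsIneq`) but has no choice rule.  This generation's adversarial search (exact-closure
annealer, code25/c/anneal_fface*.c: ≈ 2·10⁸ evaluated instances on the cells `(a,n) = (1,5..9), (2,4..7), (3,3), (3,4)` (`a + n ≤ 10`), among them
≈ 500 instances violating the per-coordinate form at SOME coordinate and near-misses with 5 of 7 coordinates bad; exhaustive on `(1,2), (1,3), (2,1),
(2,2), (3,1)`) found that the coordinate can always be read off the TEST SET ALONE: any `i` whose bottom face `faceBot i P = {s ∌ i : s ∈ P}` is
largest — equivalently, on which `P` depends least (`e_i(P) = #P − 2·#(faceBot i P)` = number of members `s ∋ i` with `s ∖ {i} ∉ P` is smallest) —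
satisfies the face-minimum inequality: 0 failures as a by-product rule in 6·10⁷ evaluations, and 0 failures under a DEDICATED attack on exactly this
coordinate (single-coordinate objective recomputed from the current `P`; 7.6·10⁷ evaluations on `(1,6..8), (2,5..7), (3,3), (3,4)`), while the same
attack on a random fixed coordinate produces per-coordinate failures within seconds.  Consistency checks: if `P` ignores `i`
(`e_i = 0`) the inequality holds in the strong sum form `B + U ≤ T` (`…SahiCombTriWFaceMinCylinder`); for principal `P = ↑s` the rule picks `i ∉ s`
(ignored) or, for `s = univ`, reduces to the principal stratum.

* `FaceMinAtMaxBotIneq` (`@[conjecture]`, typed; an obligation of this theory, never a fact) — FACE-MIN at every coordinate with a largest bottom face;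
* `faceMinExistsIneq_of_faceMinAtMaxBotIneq` — it implies `FaceMinExistsIneq` (a largest bottom face exists when the cube has a coordinate);
* `triWIneq_of_faceMinAtMaxBotIneq` — hence `TriWIneq` for every index cube.
HONEST LABEL: one definition (a conjecture with its census) and two proved reductions; `TriWIneq` remains OPEN. [this work]
-/

namespace Summit.CriticalPhenomena.PercolationContinuityZ3.Theorems

namespace FiveUpSet

open Finset

/-- **(FACE-MIN at the largest bottom face)** (CONJECTURE — an obligation of our theory, never a fact; census in the file header: 0 failures in
≈ 2·10⁸ adversarially searched instances up to `a + n = 10`, 7.6·10⁷ of them attacking exactly this coordinate).  For every up-set `P`, all monotone families of up-sets `F, G` over any index cube and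
every coordinate `i` whose bottom face of `P` has maximal cardinality, `min (triW P⁰ F⁰ G⁰) (triW P¹ F¹ G¹) ≤ triW P F G` (faces along `i`). [this work] -/
@[conjecture] def FaceMinAtMaxBotIneq : Prop :=
  ∀ (β γ : Type) [DecidableEq β] [Fintype β] [DecidableEq γ] [Fintype γ]
    (i : γ) (P : Finset (Finset γ)) (F G : Finset β → Finset (Finset γ)),
    (∀ j : γ, (faceBot j P).card ≤ (faceBot i P).card) →
    IsUpperSet (P : Set (Finset γ)) → (∀ x, IsUpperSet (F x : Set (Finset γ))) → (∀ x, IsUpperSet (G x : Set (Finset γ))) →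
    Monotone F → Monotone G →
      min (triW (faceBot i P) (fun x => faceBot i (F x)) (fun x => faceBot i (G x)))
          (triW (faceTop i P) (fun x => faceTop i (F x)) (fun x => faceTop i (G x))) ≤ triW P F G

/-- **The choice rule implies the existential form**: a coordinate with a largest bottom face exists as soon as the cube has a coordinate. [this work] -/
theorem faceMinExistsIneq_of_faceMinAtMaxBotIneq (h : FaceMinAtMaxBotIneq) : FaceMinExistsIneq := by
  intro β γ _ _ _ _ P F G hne hP hF hG hFm hGm
  obtain ⟨i, -, hi⟩ := exists_max_image (univ : Finset γ) (fun j => (faceBot j P).card) (univ_nonempty_iff.2 hne)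
  exact ⟨i, h β γ i P F G (fun j => hi j (mem_univ j)) hP hF hG hFm hGm⟩

/-- **`FaceMinAtMaxBotIneq → TriWIneq`** (via `triWIneq_of_faceMinExistsIneq`). [this work] -/
theorem triWIneq_of_faceMinAtMaxBotIneq (h : FaceMinAtMaxBotIneq) : TriWIneq :=
  triWIneq_of_faceMinExistsIneq (faceMinExistsIneq_of_faceMinAtMaxBotIneq h)

end FiveUpSet

end Summit.CriticalPhenomena.PercolationContinuityZ3.Theorems
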